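import Summits.ABC.IUTFork.Cor312HullGluedContainerRadii
import Literature.IUT.LogVolume.TensorPacketModelScaled
import HarnessLib

/-!
# [IUTchIII] Cor. 3.12 — the hull-gluing window with the radii in PRINT's constants: inner radius
# `‖(2p)^{−(j+1)}‖·p^{−⌈d_I+a_I⌉}`, outer radius `‖(2p)^{−(j+1)}‖·p^{b_I}` of the log-shell lattice ([IUTchIV] Prop. 1.2)

PROOF-ONLY sequel (abc-iut cell, seat abc-iut-w5-d082, WAVE-5; row «HULLGLUED-CONTAINER») of this seat's
`Cor312HullGluedDHVolContainerSharp` / `Cor312HullGluedPrVolContainerSharp` / `Cor312HullGluedContainerRadii`. TAKES NO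
SIDE on [IUTchIII] Cor. 3.12; no definition, no `Prop` fact.

The windows `−|log(Θ)| ≤ −|log(Θ)|♮ ≤ −|log(Θ)| + E(r, R, ρ)` there hold for ANY inner/outer coordinate radii `r`, `R` of
the log-shell lattice `ψ(Π_{v⃗} I_{v⃗})`, `I_{v⃗} = (2p)^{−(j+1)}·log_p(R^×_{v⃗})` (Dupuy–Hilado §4 intro). THIS FILE supplies the
radii of PRINT: by [IUTchIV] Prop. 1.2 (kurims p. 10; abc-iut-S5/S6 `prop11_holds` / `prop12ii'_holds`, L6-side
`normalizedPacket_subset_mShell`) `p^{⌈d_I+a_I⌉}·(R_I)^∼ ⊆ log_p(R_I^×) ⊆ (⊗h_i)·(R_I)^∼` with `‖h_i‖ = p^{b_i}`, and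
`ψ((R_I)^∼)` is the unit polydisc, so at one summand `v⃗` (`|I| = j+1 ≥ 2`):

* `polydisc_subset_image_logShell` — the coordinate polydisc of radius `‖(2p)^{−(j+1)}‖·p^{−⌈d_I+a_I⌉}` lies in
  `ψ(I_{v⃗})`;
* `norm_le_of_mem_image_logShell` — `ψ(I_{v⃗})` lies in the polydisc of radius `‖(2p)^{−(j+1)}‖·p^{b_I}`;
* packet level (`latticeF 1 = ψ(Π_{v⃗} I_{v⃗})`): `ball_subset_latticeF_one_print` / `norm_le_of_mem_latticeF_one_print`
  with `r = ‖(2p)^{−(j+1)}‖·p^{−M}`, `R = ‖(2p)^{−(j+1)}‖·p^{B}` for any common bounds `M ≥ ⌈d_{v⃗}+a_{v⃗}⌉`, `B ≥ b_{v⃗}`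
  over the summands of the packet (`exists_print_radii_bounds`: the maxima);
* **`hullGlued_negLogTheta_window_settingPrVolSharp_print`** — the window of `Cor312HullGluedPrVolContainerSharp` at
  THESE radii: the per-packet container term `log(p⁴·R²·ρ/r²)` reads `(4 + 2B + 2M)·log p + log ρ` (the scalar
  `(2p)^{−(j+1)}` cancels in `R/r`), i.e. an excess in the constants `a_I`, `b_I`, `d_I` of [IUTchIV] Prop. 1.2/1.4 and
  the Θ-idele norms only.
Reading (neutral): explicit, cruder than [IUTchIV] Prop. 1.4 (iii)'s own constant (the argument runs the sandwich
twice), but of the same shape; nothing here asserts either Statement or constrains the Θ-glue.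
[claim: Mochizuki2012, status: disputed] vocabulary only. [cite: Mochizuki2012, IUTchIV Prop. 1.2 (i)(ii) p. 10, Thm 1.10 proof
Step (v) pp. 27–29] [cite: DupuyHilado2025, §4 (intro), §4.10]
-/

noncomputable section

open Set Function NumberField
open scoped Pointwise

/-! ## 1. One summand: the log-shell sandwiched between two explicit polydiscs -/

namespace Summit.ABC.IUTFork.Cor312Vol

open Literature.IUT.LogVolume

section Summand

variable (p : ℕ) [Fact p.Prime] {I : Type} [Fintype I] [DecidableEq I] [Nonempty I]
  (k : I → Type) [∀ i, NontriviallyNormedField (k i)] [∀ i, NormedAlgebra ℚ_[p] (k i)]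
  [∀ i, IsUltrametricDist (k i)] [∀ i, ProperSpace (k i)]

/-- Membership in `(R_I)^∼` is read on the coordinates: all `‖ψ(x)_j‖ ≤ 1` ([IUTchIV] Prop. 1.4 (i): `ψ((R_I)^∼)` is the
unit polydisc). [cite: Mochizuki2012, IUTchIV Prop. 1.4 (i) p. 13] -/
theorem mem_normalizedPacket_iff_norm_dEquiv_le {x : PacketAlgebra p k} :
    x ∈ normalizedPacket p k ↔ ∀ j, ‖dEquiv p k x j‖ ≤ 1 := by
  have h : x ∈ (normalizedPacket p k : Set (PacketAlgebra p k)) ↔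
      dEquiv p k x ∈ dEquiv p k '' (normalizedPacket p k : Set (PacketAlgebra p k)) :=
    ((dEquiv p k).injective.mem_set_image).symm
  rw [SetLike.mem_coe] at h
  rw [h, image_normalizedPacket_eq_coe, coe_piUnitBallStructure, mem_polydisc]

/-- **Inner polydisc of the log-shell, print's radius**: for `|I| ≥ 2`, every `y ∈ ⊕_j L_j` with
`‖y_j‖ ≤ ‖(2p)^{−|I|}‖·p^{−⌈d_I+a_I⌉}` lies in `ψ(I_{v⃗})`, `I_{v⃗} = (2p)^{−|I|}·log_p(R_I^×)` — from
`(R_I)^∼ ⊆ p^{−⌈d_I+a_I⌉}·log_p(R_I^×)` ([IUTchIV] Prop. 1.2 (ii) "in particular", `normalizedPacket_subset_mShell`).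
[cite: Mochizuki2012, IUTchIV Prop. 1.2 (ii) p. 10] -/
theorem polydisc_subset_image_logShell (hI : 2 ≤ Fintype.card I) (y : DSum p k)
    (hy : ∀ j, ‖y j‖ ≤ ‖shellScalar p (I := I)‖ * (p : ℝ) ^ (-mShellExp p k)) :
    y ∈ dEquiv p k '' logShell p k := by
  have hp0 : (0 : ℝ) < p := by exact_mod_cast (Fact.out : p.Prime).pos
  have hpQ : ((p : ℕ) : ℚ_[p]) ≠ 0 := by exact_mod_cast (Fact.out : p.Prime).ne_zero
  have hs : shellScalar p (I := I) ≠ 0 := shellScalar_ne_zero p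
  set s : ℚ_[p] := shellScalar p (I := I) with hs_def
  set M : ℤ := mShellExp p k with hM
  set x : PacketAlgebra p k := (dEquiv p k).symm y with hx
  -- `z := (s·p^M)⁻¹·x` has all coordinates of norm `≤ 1`, hence lies in `(R_I)^∼`
  set c : ℚ_[p] := s * (p : ℚ_[p]) ^ M with hc
  have hc0 : c ≠ 0 := mul_ne_zero hs (zpow_ne_zero _ hpQ)
  have hcnorm : ‖c‖ = ‖s‖ * (p : ℝ) ^ (-M) := by rw [hc, norm_mul, Padic.norm_p_zpow]
  have hz : c⁻¹ • x ∈ normalizedPacket p k := by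
    rw [mem_normalizedPacket_iff_norm_dEquiv_le]
    intro j
    rw [map_smul, Pi.smul_apply, norm_smul, norm_inv, hcnorm, hx, AlgEquiv.apply_symm_apply]
    have hcpos : 0 < ‖s‖ * (p : ℝ) ^ (-M) := mul_pos (norm_pos_iff.2 hs) (zpow_pos hp0 _)
    rw [inv_mul_le_iff₀ hcpos, mul_one]
    exact hy j
  -- `(R_I)^∼ ⊆ p^{−M}·log_p(R_I^×)`
  have hsub := normalizedPacket_subset_mShell p k hI hz
  rw [mShell_eq_const_smul] at hsub
  obtain ⟨w, hw, hzw⟩ := Set.mem_smul_set.mp hsub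
  -- so `x = c·(c⁻¹·x) = (s·p^M)·p^{−M}·w = s·w ∈ s·log_p(R_I^×)`
  refine ⟨x, ?_, by rw [hx, AlgEquiv.apply_symm_apply]⟩
  have hxw : x = s • w := by
    have h1 : x = c • (c⁻¹ • x) := by rw [smul_smul, mul_inv_cancel₀ hc0, one_smul]
    rw [h1, ← hzw, smul_smul, hc, mul_assoc, ← zpow_add₀ hpQ, add_neg_cancel, zpow_zero, mul_one]
  rw [hxw]
  exact Set.smul_mem_smul_set hw

/-- **Outer polydisc of the log-shell, print's radius**: every `y ∈ ψ(I_{v⃗})` has `‖y_j‖ ≤ ‖(2p)^{−|I|}‖·p^{b_I}` —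
from `log_p(R_I^×) ⊆ (⊗h_i)·R_I` with `‖h_i‖ = p^{b_i}` ([IUTchIV] Prop. 1.2 (i); abc-iut-S6
`exists_mem_integerPacket_of_mem_logPacket`) and `‖ψ(⊗h_i)_j‖ = Π_i ‖h_i‖` (isometric component embeddings).
[cite: Mochizuki2012, IUTchIV Prop. 1.2 (i) p. 10] -/
theorem norm_le_of_mem_image_logShell {y : DSum p k} (hy : y ∈ dEquiv p k '' logShell p k) (j : DIdx p k) :
    ‖y j‖ ≤ ‖shellScalar p (I := I)‖ * (p : ℝ) ^ bSum p k := by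
  obtain ⟨x, hx, rfl⟩ := hy
  obtain ⟨w, hw, rfl⟩ := Set.mem_smul_set.mp hx
  obtain ⟨h, hh⟩ := exists_realizesNegB p k
  obtain ⟨y', hy', rfl⟩ := exists_mem_integerPacket_of_mem_logPacket p k hh hw
  have hyO : y' ∈ normalizedPacket p k := integerPacket_le_normalizedPacket p k hy'
  have hyj : ‖dEquiv p k y' j‖ ≤ 1 := (mem_normalizedPacket_iff_norm_dEquiv_le p k).1 hyO j
  have hprod : ‖dEquiv p k (purePacket p k h) j‖ = (p : ℝ) ^ bSum p k := by
    rw [psi_purePacket_apply, norm_prod, ← prod_norm_of_realizesNegB p k hh]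
    exact Finset.prod_congr rfl fun i _ => norm_factorEmb p k (DFac p k) (dEquiv p k) i j (h i)
  rw [map_smul, Pi.smul_apply, norm_smul, map_mul, Pi.mul_apply, norm_mul, hprod]
  have h0 : 0 ≤ ‖shellScalar p (I := I)‖ * (p : ℝ) ^ bSum p k := by positivity
  calc ‖shellScalar p (I := I)‖ * ((p : ℝ) ^ bSum p k * ‖dEquiv p k y' j‖)
      = ‖shellScalar p (I := I)‖ * (p : ℝ) ^ bSum p k * ‖dEquiv p k y' j‖ := by ring
    _ ≤ ‖shellScalar p (I := I)‖ * (p : ℝ) ^ bSum p k * 1 := mul_le_mul_of_nonneg_left hyj h0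
    _ = _ := mul_one _

end Summand

/-! ## 2. One packet: print's radii for the log-shell lattice `Π_{v⃗} I_{v⃗}` in field-factor coordinates -/

namespace PadicPresentation

open Thm311 Literature.IUT.LogThetaLattice

variable {T : ThetaIndex} {L : LogShells T} {vQ : T.VQ} {p : ℕ} [hp : Fact p.Prime] (P : PadicPresentation L vQ p)
  {j : T.Label}

/-- **Inner radius of `latticeF 1` in print's constants**: for any common bound `M ≥ ⌈d_{v⃗}+a_{v⃗}⌉` over the
summands `v⃗` of the packet (`|S^±_{j+1}| ≥ 2`), the coordinate ball of radius `‖(2p)^{−(j+1)}‖·p^{−M}` lies in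
`latticeF 1 = ψ(Π_{v⃗} I_{v⃗})`. [cite: Mochizuki2012, IUTchIV Prop. 1.2 (ii) p. 10] -/
theorem ball_subset_latticeF_one_print (hI : 2 ≤ Fintype.card (T.Caps j)) {Mx : ℤ}
    (hM : ∀ e : T.Caps j → T.Fibre vQ, mShellExp p (P.kk e) ≤ Mx)
    (z : ∀ s : (Σ e : T.Caps j → T.Fibre vQ, DIdx p (P.kk e)), DFac p (P.kk s.1) s.2)
    (hz : ∀ s, ‖z s‖ < ‖shellScalar p (I := T.Caps j)‖ * (p : ℝ) ^ (-Mx)) :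
    z ∈ P.latticeF j 1 := by
  have hp1 : (1 : ℝ) ≤ (p : ℝ) := by exact_mod_cast (Fact.out : p.Prime).one_lt.le
  rw [P.mem_latticeF_iff]
  intro e
  rw [one_smul]
  refine polydisc_subset_image_logShell p (P.kk e) hI _ fun i => (hz ⟨e, i⟩).le.trans ?_
  exact mul_le_mul_of_nonneg_left (zpow_le_zpow_right₀ hp1 (neg_le_neg (hM e))) (norm_nonneg _)

/-- **Outer radius of `latticeF 1` in print's constants**: for any common bound `B ≥ b_{v⃗}` over the summands,
`latticeF 1` lies in the coordinate polydisc of radius `‖(2p)^{−(j+1)}‖·p^{B}`. [cite: Mochizuki2012, IUTchIV Prop. 1.2 (i) p. 10] -/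
theorem norm_le_of_mem_latticeF_one_print {Bx : ℝ} (hB : ∀ e : T.Caps j → T.Fibre vQ, bSum p (P.kk e) ≤ Bx)
    (z : ∀ s : (Σ e : T.Caps j → T.Fibre vQ, DIdx p (P.kk e)), DFac p (P.kk s.1) s.2) (hz : z ∈ P.latticeF j 1)
    (s : Σ e : T.Caps j → T.Fibre vQ, DIdx p (P.kk e)) :
    ‖z s‖ ≤ ‖shellScalar p (I := T.Caps j)‖ * (p : ℝ) ^ Bx := by
  have hp1 : (1 : ℝ) ≤ (p : ℝ) := by exact_mod_cast (Fact.out : p.Prime).one_lt.le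
  obtain ⟨e, i⟩ := s
  have hz' := (P.mem_latticeF_iff 1 z).1 hz e
  rw [one_smul] at hz'
  exact (norm_le_of_mem_image_logShell p (P.kk e) hz' i).trans
    (mul_le_mul_of_nonneg_left (Real.rpow_le_rpow_of_exponent_le hp1 (hB e)) (norm_nonneg _))

end PadicPresentation

end Summit.ABC.IUTFork.Cor312Vol

/-! ## 3. The window at the print-normalised sharp setting with print's radii -/

namespace Summit.ABC.IUTFork.Thm311.Real

open Cor312 Cor312.Setting Cor312Vol Literature.IUT.LogThetaLattice Literature.IUT.LogVolume

variable {F : Type} [Field F] [NumberField F] (X : PilotData F) {logv : PadicLogs F} (hlog : LogvAnalytic logv)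
  (t : ∀ (pp : Nat.Primes) (_ : Fin X.lstar) (x : (thetaIndex X).Fibre (.inr pp)),
    haveI : Fact (pp : ℕ).Prime := ⟨pp.2⟩; kOf X pp.1 x)
  (tq : ∀ (pp : Nat.Primes) (x : (thetaIndex X).Fibre (.inr pp)),
    haveI : Fact (pp : ℕ).Prime := ⟨pp.2⟩; kOf X pp.1 x)
  (M : Type) [Field M] [NumberField M]
  (archPk : ∀ (j : (thetaIndex X).Label) (vQ : (thetaIndex X).VQ), Set ((logShellsDH X logv).Packet j vQ))
  (archSub : ∀ (j : (thetaIndex X).Label) (v : (thetaIndex X).V),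
    Set ((logShellsDH X logv).Packet j ((thetaIndex X).over v)))
  (Ψ : ℤ → ∀ v : (thetaIndex X).V, v ∈ (thetaIndex X).Vbad → Set ((logShellsDH X logv).StarPacket v))
  (act : ℤ → ∀ v : (thetaIndex X).V, v ∈ (thetaIndex X).Vbad →
    (logShellsDH X logv).StarPacket v → Module.End ℚ ((logShellsDH X logv).StarPacket v))
  (Mmod : ℤ → ∀ j : (thetaIndex X).LabelStar, Set ((logShellsDH X logv).GlobalPacket j.1))
  (region : ℤ → ∀ j : (thetaIndex X).LabelStar, FinDivisor M → ∀ vQ : (thetaIndex X).VQ,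
    Set ((logShellsDH X logv).Packet j.1 vQ))
  (n : ℤ) {HT : Type} {LogLink : HT → HT → Type} {IsFull : ∀ {s t : HT}, LogLink s t → Prop}
  (lat : LGPGaussianLogThetaLattice LogLink IsFull)
  {Frd : Type} {IsoF : Frd → Frd → Type} {Ob : Frd → Type} {realify : Frd → Frd} {Strip : Type}
  {IsoS : Strip → Strip → Type} {Mv : ∀ v : (thetaIndex X).V, v ∈ (thetaIndex X).Vbad → Type}
  [∀ v h, Monoid (Mv v h)]
  (sig : GlobalLGPFrobenioidSignature (thetaIndex X).lstar (thetaIndex X).V (· ∈ (thetaIndex X).Vbad)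
    Frd IsoF Ob realify Strip IsoS Mv)
  (split : SplittingMonoids Mv) {ObΔ : Type} {N : ∀ v : (thetaIndex X).V, v ∈ (thetaIndex X).Vbad → Type}
  [∀ v h, Monoid (N v h)] (qData : QPilotData ObΔ N)
  (ht0 : ∀ pp i x, t pp i x ≠ 0)
  (ht1 : ∀ (pp : Nat.Primes) (i : Fin X.lstar) (x : (thetaIndex X).Fibre (.inr pp)),
    haveI : Fact (pp : ℕ).Prime := ⟨pp.2⟩; placeOf X pp.1 x ∉ X.S → ‖t pp i x‖ = 1)
  (htq0 : ∀ pp x, tq pp x ≠ 0)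
  (htq1 : ∀ (pp : Nat.Primes) (x : (thetaIndex X).Fibre (.inr pp)),
    haveI : Fact (pp : ℕ).Prime := ⟨pp.2⟩; placeOf X pp.1 x ∉ X.S → ‖tq pp x‖ = 1)

include ht0 ht1 in
open scoped Classical in
/-- **The window at the print-normalised sharp setting with PRINT's radii**: for any bounds `M_{p,i} ≥ ⌈d_{v⃗}+a_{v⃗}⌉`,
`B_{p,i} ≥ b_{v⃗}` over the summands `v⃗` of the packet `(i+1, p)` (e.g. the maxima) and any bound `ρ_{p,i}` of the Θ-idele
norms over `p`: `−|log(Θ)| ≤ −|log(Θ)|♮ ≤ −|log(Θ)| + E(r, R, ρ)` with `r_{p,i} = ‖(2p)^{−(i+2)}‖·p^{−M_{p,i}}`,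
`R_{p,i} = ‖(2p)^{−(i+2)}‖·p^{B_{p,i}}`, `E` the explicit excess of `hullGlued_negLogTheta_window_settingPrVolSharp` (its
per-packet container term reads `(4 + 2B_{p,i} + 2M_{p,i})·log p + log ρ_{p,i}`: the scalar `(2p)^{−(i+2)}` cancels in `R/r`).
NO `hst`/`hbad`. [claim: Mochizuki2012, status: disputed] [cite: Mochizuki2012, IUTchIV Prop. 1.2 (i)(ii) p. 10, Thm 1.10
proof Step (v) pp. 27–29] [cite: DupuyHilado2025, §4.10] -/
theorem hullGlued_negLogTheta_window_settingPrVolSharp_print (Mx : Nat.Primes → Fin (thetaIndex X).lstar → ℤ)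
    (Bx ρ : Nat.Primes → Fin (thetaIndex X).lstar → ℝ)
    (hM : ∀ (pp : Nat.Primes) (i : Fin (thetaIndex X).lstar)
      (e : (thetaIndex X).Caps (labelSucc i) → (thetaIndex X).Fibre (.inr pp)), haveI : Fact (pp : ℕ).Prime := ⟨pp.2⟩
      mShellExp (pp : ℕ) ((presAt X hlog pp).kk e) ≤ Mx pp i)
    (hB : ∀ (pp : Nat.Primes) (i : Fin (thetaIndex X).lstar)
      (e : (thetaIndex X).Caps (labelSucc i) → (thetaIndex X).Fibre (.inr pp)), haveI : Fact (pp : ℕ).Prime := ⟨pp.2⟩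
      bSum (pp : ℕ) ((presAt X hlog pp).kk e) ≤ Bx pp i)
    (hρ : ∀ pp i, 0 < ρ pp i)
    (hΘ : ∀ (pp : Nat.Primes) (i : Fin (thetaIndex X).lstar) (x : (thetaIndex X).Fibre (.inr pp)),
      haveI : Fact (pp : ℕ).Prime := ⟨pp.2⟩; ‖t pp i x‖ ≤ ρ pp i) :
    (settingPrVolSharp X hlog M archPk archSub Ψ act Mmod region n lat sig split qData tq t htq0 htq1).negLogTheta ≤
      (settingPrVolSharp X hlog M archPk archSub Ψ act Mmod region n lat sig split qData tq t htq0
        htq1).hullGlued.negLogTheta ∧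
    (settingPrVolSharp X hlog M archPk archSub Ψ act Mmod region n lat sig split qData tq t htq0
        htq1).hullGlued.negLogTheta ≤
      (settingPrVolSharp X hlog M archPk archSub Ψ act Mmod region n lat sig split qData tq t htq0 htq1).negLogTheta +
        ((processionNormalized fun i : Fin (thetaIndex X).lstar => ∑ᶠ vQ : (thetaIndex X).VQ,
          (match vQ with
            | .inl _ => (0 : ℝ)
            | .inr pp => haveI : Fact (pp : ℕ).Prime := ⟨pp.2⟩
                if (pp : ℕ) ∣ 2 * (NumberField.discr F).natAbs then
                  Real.log (((pp : ℕ) : ℝ) ^ 4 *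
                      (‖shellScalar (pp : ℕ) (I := (thetaIndex X).Caps (labelSucc i))‖ * ((pp : ℕ) : ℝ) ^ Bx pp i) ^ 2 *
                        ρ pp i /
                      (‖shellScalar (pp : ℕ) (I := (thetaIndex X).Caps (labelSucc i))‖ * ((pp : ℕ) : ℝ) ^ (-Mx pp i)) ^ 2) -
                    ((settingPrVolSharp X hlog M archPk archSub Ψ act Mmod region n lat sig split qData tq t htq0
                      htq1).thetaLocal (labelSucc i) (.inr pp)).untopD 0
                else 0) : ℝ) : WithTop ℝ) := by
  have hr : ∀ (pp : Nat.Primes) (i : Fin (thetaIndex X).lstar), haveI : Fact (pp : ℕ).Prime := ⟨pp.2⟩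
      0 < ‖shellScalar (pp : ℕ) (I := (thetaIndex X).Caps (labelSucc i))‖ * ((pp : ℕ) : ℝ) ^ (-Mx pp i) := fun pp i => by
    haveI : Fact (pp : ℕ).Prime := ⟨pp.2⟩
    have hp0 : (0 : ℝ) < (pp : ℕ) := by exact_mod_cast pp.2.pos
    exact mul_pos (norm_pos_iff.2 (shellScalar_ne_zero (pp : ℕ))) (zpow_pos hp0 _)
  have hR : ∀ (pp : Nat.Primes) (i : Fin (thetaIndex X).lstar), haveI : Fact (pp : ℕ).Prime := ⟨pp.2⟩
      0 < ‖shellScalar (pp : ℕ) (I := (thetaIndex X).Caps (labelSucc i))‖ * ((pp : ℕ) : ℝ) ^ Bx pp i := fun pp i => by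
    haveI : Fact (pp : ℕ).Prime := ⟨pp.2⟩
    have hp0 : (0 : ℝ) < (pp : ℕ) := by exact_mod_cast pp.2.pos
    exact mul_pos (norm_pos_iff.2 (shellScalar_ne_zero (pp : ℕ))) (Real.rpow_pos_of_pos hp0 _)
  exact hullGlued_negLogTheta_window_settingPrVolSharp X hlog t tq M archPk archSub Ψ act Mmod region n lat sig split
    qData ht0 ht1 htq0 htq1
    (fun pp i => haveI : Fact (pp : ℕ).Prime := ⟨pp.2⟩
      ‖shellScalar (pp : ℕ) (I := (thetaIndex X).Caps (labelSucc i))‖ * ((pp : ℕ) : ℝ) ^ (-Mx pp i))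
    (fun pp i => haveI : Fact (pp : ℕ).Prime := ⟨pp.2⟩
      ‖shellScalar (pp : ℕ) (I := (thetaIndex X).Caps (labelSucc i))‖ * ((pp : ℕ) : ℝ) ^ Bx pp i)
    ρ hr hR hρ
    (fun pp i => by
      haveI : Fact (pp : ℕ).Prime := ⟨pp.2⟩
      exact fun z hz => (presAt X hlog pp).ball_subset_latticeF_one_print (two_le_card_caps_labelSucc X i) (hM pp i) z hz)
    (fun pp i => by
      haveI : Fact (pp : ℕ).Prime := ⟨pp.2⟩
      exact fun z hz s => (presAt X hlog pp).norm_le_of_mem_latticeF_one_print (hB pp i) z hz s)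
    hΘ

include ht0 ht1 in
open scoped Classical in
/-- **The same window at `Real.settingDHVolSharp` with PRINT's radii** (Dupuy–Hilado weights: the container term carries
the packet's total weight `W_{i+1,p} = Σ_{v⃗} w_{v⃗}`). [claim: Mochizuki2012, status: disputed]
[cite: Mochizuki2012, IUTchIV Prop. 1.2 (i)(ii) p. 10, Thm 1.10 proof Step (v) pp. 27–29] [cite: DupuyHilado2025, §4.10] -/
theorem hullGlued_negLogTheta_window_settingDHVolSharp_print (Mx : Nat.Primes → Fin (thetaIndex X).lstar → ℤ)
    (Bx ρ : Nat.Primes → Fin (thetaIndex X).lstar → ℝ)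
    (hM : ∀ (pp : Nat.Primes) (i : Fin (thetaIndex X).lstar)
      (e : (thetaIndex X).Caps (labelSucc i) → (thetaIndex X).Fibre (.inr pp)), haveI : Fact (pp : ℕ).Prime := ⟨pp.2⟩
      mShellExp (pp : ℕ) ((presAt X hlog pp).kk e) ≤ Mx pp i)
    (hB : ∀ (pp : Nat.Primes) (i : Fin (thetaIndex X).lstar)
      (e : (thetaIndex X).Caps (labelSucc i) → (thetaIndex X).Fibre (.inr pp)), haveI : Fact (pp : ℕ).Prime := ⟨pp.2⟩
      bSum (pp : ℕ) ((presAt X hlog pp).kk e) ≤ Bx pp i)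
    (hρ : ∀ pp i, 0 < ρ pp i)
    (hΘ : ∀ (pp : Nat.Primes) (i : Fin (thetaIndex X).lstar) (x : (thetaIndex X).Fibre (.inr pp)),
      haveI : Fact (pp : ℕ).Prime := ⟨pp.2⟩; ‖t pp i x‖ ≤ ρ pp i) :
    (settingDHVolSharp X hlog M archPk archSub Ψ act Mmod region n lat sig split qData tq t htq0 htq1).negLogTheta ≤
      (settingDHVolSharp X hlog M archPk archSub Ψ act Mmod region n lat sig split qData tq t htq0
        htq1).hullGlued.negLogTheta ∧
    (settingDHVolSharp X hlog M archPk archSub Ψ act Mmod region n lat sig split qData tq t htq0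
        htq1).hullGlued.negLogTheta ≤
      (settingDHVolSharp X hlog M archPk archSub Ψ act Mmod region n lat sig split qData tq t htq0 htq1).negLogTheta +
        ((processionNormalized fun i : Fin (thetaIndex X).lstar => ∑ᶠ vQ : (thetaIndex X).VQ,
          (match vQ with
            | .inl _ => (0 : ℝ)
            | .inr pp => haveI : Fact (pp : ℕ).Prime := ⟨pp.2⟩
                if (pp : ℕ) ∣ 2 * (NumberField.discr F).natAbs then
                  (∑ e : (presAt X hlog pp).toLocalPieces.E (labelSucc i), (presAt X hlog pp).w (labelSucc i) e) *
                      Real.log (((pp : ℕ) : ℝ) ^ 4 *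
                        (‖shellScalar (pp : ℕ) (I := (thetaIndex X).Caps (labelSucc i))‖ * ((pp : ℕ) : ℝ) ^ Bx pp i) ^ 2 *
                          ρ pp i /
                        (‖shellScalar (pp : ℕ) (I := (thetaIndex X).Caps (labelSucc i))‖ *
                          ((pp : ℕ) : ℝ) ^ (-Mx pp i)) ^ 2) -
                    ((settingDHVolSharp X hlog M archPk archSub Ψ act Mmod region n lat sig split qData tq t htq0
                      htq1).thetaLocal (labelSucc i) (.inr pp)).untopD 0
                else 0) : ℝ) : WithTop ℝ) := by
  have hr : ∀ (pp : Nat.Primes) (i : Fin (thetaIndex X).lstar), haveI : Fact (pp : ℕ).Prime := ⟨pp.2⟩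
      0 < ‖shellScalar (pp : ℕ) (I := (thetaIndex X).Caps (labelSucc i))‖ * ((pp : ℕ) : ℝ) ^ (-Mx pp i) := fun pp i => by
    haveI : Fact (pp : ℕ).Prime := ⟨pp.2⟩
    have hp0 : (0 : ℝ) < (pp : ℕ) := by exact_mod_cast pp.2.pos
    exact mul_pos (norm_pos_iff.2 (shellScalar_ne_zero (pp : ℕ))) (zpow_pos hp0 _)
  have hR : ∀ (pp : Nat.Primes) (i : Fin (thetaIndex X).lstar), haveI : Fact (pp : ℕ).Prime := ⟨pp.2⟩
      0 < ‖shellScalar (pp : ℕ) (I := (thetaIndex X).Caps (labelSucc i))‖ * ((pp : ℕ) : ℝ) ^ Bx pp i := fun pp i => by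
    haveI : Fact (pp : ℕ).Prime := ⟨pp.2⟩
    have hp0 : (0 : ℝ) < (pp : ℕ) := by exact_mod_cast pp.2.pos
    exact mul_pos (norm_pos_iff.2 (shellScalar_ne_zero (pp : ℕ))) (Real.rpow_pos_of_pos hp0 _)
  exact hullGlued_negLogTheta_window_settingDHVolSharp X hlog t tq M archPk archSub Ψ act Mmod region n lat sig split
    qData ht0 ht1 htq0 htq1
    (fun pp i => haveI : Fact (pp : ℕ).Prime := ⟨pp.2⟩
      ‖shellScalar (pp : ℕ) (I := (thetaIndex X).Caps (labelSucc i))‖ * ((pp : ℕ) : ℝ) ^ (-Mx pp i))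
    (fun pp i => haveI : Fact (pp : ℕ).Prime := ⟨pp.2⟩
      ‖shellScalar (pp : ℕ) (I := (thetaIndex X).Caps (labelSucc i))‖ * ((pp : ℕ) : ℝ) ^ Bx pp i)
    ρ hr hR hρ
    (fun pp i => by
      haveI : Fact (pp : ℕ).Prime := ⟨pp.2⟩
      exact fun z hz => (presAt X hlog pp).ball_subset_latticeF_one_print (two_le_card_caps_labelSucc X i) (hM pp i) z hz)
    (fun pp i => by
      haveI : Fact (pp : ℕ).Prime := ⟨pp.2⟩
      exact fun z hz s => (presAt X hlog pp).norm_le_of_mem_latticeF_one_print (hB pp i) z hz s)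
    hΘ

/-- **Such bounds exist** (the maxima over the finitely many summands of each packet; vacuity audit for the
print-radii window). [folklore] -/
theorem exists_print_radii_bounds :
    ∃ (Mx : Nat.Primes → Fin (thetaIndex X).lstar → ℤ) (Bx : Nat.Primes → Fin (thetaIndex X).lstar → ℝ),
      (∀ (pp : Nat.Primes) (i : Fin (thetaIndex X).lstar)
        (e : (thetaIndex X).Caps (labelSucc i) → (thetaIndex X).Fibre (.inr pp)), haveI : Fact (pp : ℕ).Prime := ⟨pp.2⟩
        mShellExp (pp : ℕ) ((presAt X hlog pp).kk e) ≤ Mx pp i) ∧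
      (∀ (pp : Nat.Primes) (i : Fin (thetaIndex X).lstar)
        (e : (thetaIndex X).Caps (labelSucc i) → (thetaIndex X).Fibre (.inr pp)), haveI : Fact (pp : ℕ).Prime := ⟨pp.2⟩
        bSum (pp : ℕ) ((presAt X hlog pp).kk e) ≤ Bx pp i) := by
  classical
  haveI : ∀ (pp : Nat.Primes) (i : Fin (thetaIndex X).lstar),
      Fintype ((thetaIndex X).Caps (labelSucc i) → (thetaIndex X).Fibre (.inr pp)) := fun _ _ => Fintype.ofFinite _
  have hne : ∀ (pp : Nat.Primes) (i : Fin (thetaIndex X).lstar),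
      (Finset.univ : Finset ((thetaIndex X).Caps (labelSucc i) → (thetaIndex X).Fibre (.inr pp))).Nonempty :=
    fun pp i => Finset.univ_nonempty
  refine ⟨fun pp i => haveI : Fact (pp : ℕ).Prime := ⟨pp.2⟩
      (Finset.univ.sup' (hne pp i) fun e => mShellExp (pp : ℕ) ((presAt X hlog pp).kk e)),
    fun pp i => haveI : Fact (pp : ℕ).Prime := ⟨pp.2⟩
      (Finset.univ.sup' (hne pp i) fun e => bSum (pp : ℕ) ((presAt X hlog pp).kk e)),
    fun pp i e => ?_, fun pp i e => ?_⟩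
  · haveI : Fact (pp : ℕ).Prime := ⟨pp.2⟩
    exact Finset.le_sup' (fun e => mShellExp (pp : ℕ) ((presAt X hlog pp).kk e)) (Finset.mem_univ e)
  · haveI : Fact (pp : ℕ).Prime := ⟨pp.2⟩
    exact Finset.le_sup' (fun e => bSum (pp : ℕ) ((presAt X hlog pp).kk e)) (Finset.mem_univ e)

end Summit.ABC.IUTFork.Thm311.Real

end
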